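import Literature.MathematicalPhysics.QuantumFieldTheory.Balaban1983to89.B13Bound226Witness

/-!
# `Balaban1983to89.B13Bound226WitnessSigma` — T. Bałaban, *Renormalization group approach to lattice gauge field theories. II.
Cluster expansions*, Commun. Math. Phys. **116** (1988) 1–22 [Balaban1988RG2Cluster], pp. 15–17: **THE (2.26) CAPSTONE's BINDER
LIST IS MET BY σ-DEPENDENT KERNELS** — the A2 ∕ A6 joint witness of `B13Bound226Witness.h226_windowDilated_model` with the
σ-constant model kernels `A(σ) = 1`, `G(σ) = Γ₀` REPLACED by the σ-AFFINE `A(σ) = (1 + ε·σ(z₀))·1`, `G(σ) = (1 + ε·σ(z₀))·Γ₀` on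
the σ-polydisc `‖σ(·)‖ < e^{κ₁} + 1` (`ε = ρ_σ∕(e^{κ₁} + 1)`, `ρ_σ = 1∕(512·81^ν)`), so that ALL THREE (L16a) letters are exercised
non-trivially (`θ_E = ρ_σ`, `θ_C = 2ρ_σ`, `θ_Γ = ρ_σ∕2`, `K_{Cσ} = 2`, `K_G = (1 + ρ_σ)∕2`) and the honesty theorem
`B13SigmaFreeKernels.term214_sigmaFree` (σ-constant kernels give the zero term) does NOT apply to the witnessed term — for EVERY
torus, site torus, block, term label, large-field radius and constants record of the chain; certified by APPLYING
`B13Term214WindowDilated.h226_torus_windowDilated_of_primitives` with every binder discharged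

statement-level skeleton of published theorems with citation tags; proofs where landed; nothing here is a claim about the
Yang–Mills mass gap

CITATION HEADER.  As in `B13Bound226Witness` ([II] (2.16)–(2.17) p.16 for the kernel letters, (2.22) p.16, (2.24)–(2.26) p.17).
NOT PRINTED: the model data (WITNESS DATA for typed hypothesis lists, not Bałaban's objects).

WHY THIS FILE (cell `pub-ymgap`, D-0062 Track A, node N10 = [B13], seat `pub-ymgap-dag-n10-c` g10, module 54; companion of
modules 52 ∕ 53).  Module 52's honest label: its model kernels are σ-CONSTANT, so off `Z′₀` the witnessed (2.14) term is the zero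
term and only the CONSISTENCY of the binder list is certified.  This file removes that caveat for the KERNELS: with
`A(σ) = (1 + εσ(z₀))·1` and `G(σ) = (1 + εσ(z₀))·Γ₀` the letters `hG`, `hdΓ`, `hCs`, `hdC`, `hdE` are exercised on genuinely
σ-dependent kernels over the whole σ-polydisc, `Re(b²A(σ)) ≻ 0` is DERIVED inside the engine from the transported E-letter at
a non-zero `θ_E`, and the binder list — with the whole (L16a) block non-trivial — is still jointly consistent for every `ν`
(numbers `ρ_σ = 1∕(512·81^ν)`, `θ_E′ = 4ρ_σ`, `θ_Γ′ = 2ρ_σ`, `K_{Cσ}′ = 8`, `θ_C′ = 22ρ_σ`, `K_G′ = 1`, `θ = 1∕(16·9^ν)` as in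
module 52; `hθR1le`: 56∕1024 ≤ 64∕1024).

THE MODEL (changes w.r.t. `B13Bound226Witness`).  σ-polydisc `U_σ = ball 0 R_σ`, `R_σ := e^{κ₁} + 1` (contains the closed
`e^{κ₁}`-disc); precision `Aσ c ν z₀ σ := (1 + (ρ_σ∕R_σ)·σ(z₀))·1` (entrywise holomorphic, symmetric), cross kernel
`Gσ c ν z₀ σ := (1 + (ρ_σ∕R_σ)·σ(z₀))·Γ₀`, `Γσ … σ X := G(σ)·X`; on `U_σ`: `|εσ(z₀)| ≤ ρ_σ ≤ ½`, so `A(σ)⁻¹ = (1 + εσ(z₀))⁻¹·1`,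
`|A − C⁻¹| ≤ ρ_σ`, `|A⁻¹ − C| ≤ 2ρ_σ`, `|A⁻¹| ≤ 2`, `|G| ≤ (1 + ρ_σ)∕2`, `|G − Γ₀| ≤ ρ_σ∕2` (`scalar_letters`, `lettersS_model`);
everything else (real references `C = 1`, `Γ₀ ≡ ½`, characteristic functions, potentials, τ-regions, rates `3, 2, 1`, `θ`,
`c_E`, `g`, `a`, `a₅`) as in module 52, whose lemmas are used BY NAME.

WHAT IS HERE.  §1 `rhoS`, `Rsig`, `Aσ`, `Gσ`, `Γσ` (defs) + `rhoS_pos_le`, `Rsig_pos`, `scalar_letters`, `eps_sigma_le`,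
`lettersS_model` (the eight kernel letters in the engine's binder shapes: `hGhol`, `hG`, `hdΓ`, `hAhol`, `hAs`, `hCs`, `hdC`,
`hdE`), `Aσ_ne` (σ-DEPENDENCE: `A(σ) ≠ A(0)` at an admissible `σ`); §2 the ν-uniform numerics at `ρ_σ` (`transportsS_model`, `rhoS_le_thetaW`, `hθR1le_S_model`); §3 ★★
`h226_windowDilated_sigma_model` (41 §4 APPLIED at the σ-affine model, every binder discharged; conclusion on the non-empty
ball `|b − 1| < ρ_σ`, `one_mem_ball_rhoS`).
HONEST SCOPE.  A CONSISTENCY certificate with σ-dependent kernels (the last line is σ-free, as in print); one bond, no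
`C₀`-variables; the VALUE of the witnessed term is not computed; nothing of Bałaban's asserted;
count-neutral; N10 ∕ N22 NOT discharged; nothing continuum ∕ OS ∕ mass-gap ∕ Clay.  No `sorry`; three transparent model `def`s;
no structure, no instance, no new named fact (D-0026).
-/

noncomputable section

namespace Literature.MathematicalPhysics.QuantumFieldTheory.Balaban1983to89.B13Bound226WitnessSigma

open Matrix MeasureTheory Finset Complex Metric Set
open scoped Real
open B13Term214 (core214 F214 term214)
open B13Term214WindowDilated (h226_torus_windowDilated_of_primitives)
open B13Bound226Witness
open TreeLengthTorus (TPt TDom tsys)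
open TreeLengthTorusTransfer (tclosure)
open B13Lemma3TorusData (TBond)
open B13Lemma3TorusTerms (weight Z0)
open B13Bound143 (invTau)
open B5TorusCover (UT)
open B9Thm37GlueTorus (tdist1)

/-! ## §1. The σ-affine precision and its letters -/

section Precision

/-- MODEL (witness data). The radius of the `b`-ball ∕ the size of the σ-dependence: `ρ_σ := 1∕(512·(3^ν)⁴)`.
[cite: Balaban1988RG2Cluster, (2.24) p.17] -/
def rhoS (ν : ℕ) : ℝ := 1 / (512 * ((3 : ℝ) ^ ν) ^ 4)

/-- MODEL (witness data). The radius of the σ-discs: `R_σ := e^{κ₁} + 1` (the polydisc of radius `R_σ` contains the closed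
`e^{κ₁}`-polydisc of (2.14)). [cite: Balaban1988RG2Cluster, (2.14) p.15] -/
def Rsig (c : B13.Consts) : ℝ := Real.exp c.κ₁ + 1

/-- MODEL (witness data). THE σ-AFFINE PRECISION of the model: `A(σ) := (1 + (ρ_σ∕R_σ)·σ(z₀))·1` on one bond, `z₀` a block of
the coarse torus. [cite: Balaban1988RG2Cluster, (2.16)–(2.17) p.16] -/
def Aσ {ι : Type*} (c : B13.Consts) (ν : ℕ) (z₀ : ι) (σ : ι → ℂ) : Matrix (Fin 1) (Fin 1) ℂ :=
  (1 + ((rhoS ν / Rsig c : ℝ) : ℂ) * σ z₀) • (1 : Matrix (Fin 1) (Fin 1) ℂ)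

/-- MODEL (witness data). THE σ-AFFINE CROSS KERNEL of the model: `G(σ) := (1 + (ρ_σ∕R_σ)·σ(z₀))·Γ₀` (`Γ₀ ≡ ½`).
[cite: Balaban1988RG2Cluster, (2.16)–(2.17) p.16] -/
def Gσ {ι : Type*} (c : B13.Consts) (ν : ℕ) (z₀ : ι) (σ : ι → ℂ) : Matrix (Fin 1) (Fin 1 ⊕ Fin 0) ℂ :=
  (1 + ((rhoS ν / Rsig c : ℝ) : ℂ) * σ z₀) • Gm

/-- MODEL (witness data). The σ-dependent cross operator `Γ(σ)X := G(σ)·X` of the model. [cite: Balaban1988RG2Cluster, (2.14) p.15] -/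
def Γσ {ι : Type*} (c : B13.Consts) (ν : ℕ) (z₀ : ι) (σ : ι → ℂ) (X : Fin 1 ⊕ Fin 0 → ℝ) : Fin 1 → ℂ :=
  Gσ c ν z₀ σ *ᵥ fun j => (X j : ℂ)

variable (ν : ℕ)

/-- `0 < ρ_σ ≤ 1∕512`. [cite: Balaban1988RG2Cluster, (2.24) p.17] -/
theorem rhoS_pos_le : 0 < rhoS ν ∧ rhoS ν ≤ 1 / 512 := by
  have hu : (1 : ℝ) ≤ (3 : ℝ) ^ ν := one_le_pow₀ (by norm_num)
  refine ⟨by unfold rhoS; positivity, ?_⟩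
  unfold rhoS
  rw [div_le_div_iff₀ (by positivity) (by norm_num), one_mul, one_mul]
  nlinarith [one_le_pow₀ (M₀ := ℝ) (n := 4) hu]

/-- `R_σ > 0`. [cite: Balaban1988RG2Cluster, (2.14) p.15] -/
theorem Rsig_pos (c : B13.Consts) : 0 < Rsig c := by unfold Rsig; positivity

/-- **THE SCALAR LETTERS**: for a complex number `w` with `‖w‖ ≤ ρ ≤ ½`, `1 + w ≠ 0`, `‖(1 + w) − 1‖ ≤ ρ`, `‖(1 + w)⁻¹‖ ≤ 2` and
`‖(1 + w)⁻¹ − 1‖ ≤ 2ρ`. [cite: Balaban1988RG2Cluster, (2.16)–(2.17) p.16] -/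
theorem scalar_letters {w : ℂ} {ρ : ℝ} (hw : ‖w‖ ≤ ρ) (hρ : ρ ≤ 1 / 2) :
    1 + w ≠ 0 ∧ ‖(1 + w) - 1‖ ≤ ρ ∧ ‖(1 + w)⁻¹‖ ≤ 2 ∧ ‖(1 + w)⁻¹ - 1‖ ≤ 2 * ρ := by
  have hρ0 : 0 ≤ ρ := (norm_nonneg w).trans hw
  have hlow : 1 / 2 ≤ ‖1 + w‖ := by
    have h := norm_sub_norm_le (1 : ℂ) (-w)
    rw [sub_neg_eq_add, norm_one, norm_neg] at h
    linarith
  have hne : 1 + w ≠ 0 := fun h => by rw [h, norm_zero] at hlow; linarith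
  have hinv : ‖(1 + w)⁻¹‖ ≤ 2 := by
    rw [norm_inv]
    calc ‖1 + w‖⁻¹ ≤ (1 / 2 : ℝ)⁻¹ := inv_anti₀ (by norm_num) hlow
      _ = 2 := by norm_num
  refine ⟨hne, by rw [add_sub_cancel_left]; exact hw, hinv, ?_⟩
  have h : (1 + w)⁻¹ - 1 = -(w * (1 + w)⁻¹) := by field_simp; ring
  rw [h, norm_neg, norm_mul]
  calc ‖w‖ * ‖(1 + w)⁻¹‖ ≤ ρ * 2 := mul_le_mul hw hinv (norm_nonneg _) hρ0
    _ = 2 * ρ := mul_comm _ _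

/-- The inverse of a non-zero scalar multiple of the identity: `(w·1)⁻¹ = w⁻¹·1`. [folklore] -/
private theorem smul_one_inv {n : Type} [Fintype n] [DecidableEq n] {w : ℂ} (hw : w ≠ 0) :
    (w • (1 : Matrix n n ℂ))⁻¹ = w⁻¹ • (1 : Matrix n n ℂ) :=
  Matrix.inv_eq_right_inv (by rw [smul_mul_smul_comm, mul_one, mul_inv_cancel₀ hw, one_smul])

/-- On the σ-polydisc of radius `R_σ` the σ-dependent part of the model precision is small: `‖(ρ_σ∕R_σ)·σ(z₀)‖ ≤ ρ_σ`.
[cite: Balaban1988RG2Cluster, (2.14) p.15] -/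
theorem eps_sigma_le {ι : Type*} (c : B13.Consts) (z₀ : ι) (σ : ι → ℂ) (hσ : ∀ j, σ j ∈ ball (0 : ℂ) (Rsig c)) :
    ‖((rhoS ν / Rsig c : ℝ) : ℂ) * σ z₀‖ ≤ rhoS ν := by
  have hR := Rsig_pos c
  have hρ := (rhoS_pos_le ν).1
  have hz : ‖σ z₀‖ ≤ Rsig c := (mem_ball_zero_iff.mp (hσ z₀)).le
  rw [norm_mul, Complex.norm_real, Real.norm_of_nonneg (by positivity)]
  calc rhoS ν / Rsig c * ‖σ z₀‖ ≤ rhoS ν / Rsig c * Rsig c := mul_le_mul_of_nonneg_left hz (by positivity)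
    _ = rhoS ν := div_mul_cancel₀ _ hR.ne'

variable {ν' : ℕ} (Nf : Fin ν' → ℕ) [∀ i, NeZero (Nf i)]

/-- **THE KERNEL LETTERS OF THE σ-AFFINE MODEL**, in the binder shapes of the capstone (every bond at the base site), on the
σ-polydisc of radius `R_σ`: for the cross kernel `G(σ)` — entrywise holomorphy, `|G(σ)| ≤ (1 + ρ_σ)∕2`, `|G(σ) − Γ₀| ≤ ρ_σ∕2`;
for the precision `A(σ)` — entrywise holomorphy, symmetry, `|A(σ)⁻¹| ≤ 2`, `|A(σ)⁻¹ − C| ≤ 2ρ_σ`, `|A(σ) − C⁻¹| ≤ ρ_σ` (`C = 1`).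
[cite: Balaban1988RG2Cluster, (2.16)–(2.17) p.16] -/
theorem lettersS_model {ι : Type*} [Fintype ι] (c : B13.Consts) (z₀ : ι) :
    (∀ i j, DifferentiableOn ℂ (fun σ : ι → ℂ => Gσ c ν z₀ σ i j) {σ | ∀ j, σ j ∈ ball (0 : ℂ) (Rsig c)}) ∧
    (∀ σ : ι → ℂ, (∀ j, σ j ∈ ball (0 : ℂ) (Rsig c)) →
      ∀ b j, ‖Gσ c ν z₀ σ b j‖ ≤ (1 + rhoS ν) / 2 * Real.exp (-(3 * tdist1 Nf (x0 Nf) (x0 Nf)))) ∧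
    (∀ σ : ι → ℂ, (∀ j, σ j ∈ ball (0 : ℂ) (Rsig c)) →
      ∀ b j, ‖(Gσ c ν z₀ σ - Gam0.map (algebraMap ℝ ℂ)) b j‖ ≤ rhoS ν / 2 * Real.exp (-(3 * tdist1 Nf (x0 Nf) (x0 Nf)))) ∧
    (∀ i j, DifferentiableOn ℂ (fun σ : ι → ℂ => Aσ c ν z₀ σ i j) {σ | ∀ j, σ j ∈ ball (0 : ℂ) (Rsig c)}) ∧
    (∀ σ : ι → ℂ, (∀ j, σ j ∈ ball (0 : ℂ) (Rsig c)) → (Aσ c ν z₀ σ).IsSymm) ∧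
    (∀ σ : ι → ℂ, (∀ j, σ j ∈ ball (0 : ℂ) (Rsig c)) →
      ∀ b b', ‖(Aσ c ν z₀ σ)⁻¹ b b'‖ ≤ 2 * Real.exp (-(3 * tdist1 Nf (x0 Nf) (x0 Nf)))) ∧
    (∀ σ : ι → ℂ, (∀ j, σ j ∈ ball (0 : ℂ) (Rsig c)) →
      ∀ b b', ‖((Aσ c ν z₀ σ)⁻¹ - (1 : Matrix (Fin 1) (Fin 1) ℝ).map (algebraMap ℝ ℂ)) b b'‖
        ≤ 2 * rhoS ν * Real.exp (-(3 * tdist1 Nf (x0 Nf) (x0 Nf)))) ∧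
    (∀ σ : ι → ℂ, (∀ j, σ j ∈ ball (0 : ℂ) (Rsig c)) →
      ∀ b b', ‖(Aσ c ν z₀ σ - (1 : Matrix (Fin 1) (Fin 1) ℝ)⁻¹.map (algebraMap ℝ ℂ)) b b'‖
        ≤ rhoS ν * Real.exp (-(3 * tdist1 Nf (x0 Nf) (x0 Nf)))) := by
  have hw1 := exp_tdist1_x0 Nf (3 : ℝ)
  have hmap1 : ((1 : Matrix (Fin 1) (Fin 1) ℝ)).map (algebraMap ℝ ℂ) = 1 := Matrix.map_one _ (map_zero _) (map_one _)
  have hρ12 : rhoS ν ≤ 1 / 2 := (rhoS_pos_le ν).2.trans (by norm_num)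
  -- the scalar letters at an admissible σ
  have key : ∀ σ : ι → ℂ, (∀ j, σ j ∈ ball (0 : ℂ) (Rsig c)) →
      1 + ((rhoS ν / Rsig c : ℝ) : ℂ) * σ z₀ ≠ 0 ∧ ‖(1 + ((rhoS ν / Rsig c : ℝ) : ℂ) * σ z₀) - 1‖ ≤ rhoS ν ∧
      ‖(1 + ((rhoS ν / Rsig c : ℝ) : ℂ) * σ z₀)⁻¹‖ ≤ 2 ∧
      ‖(1 + ((rhoS ν / Rsig c : ℝ) : ℂ) * σ z₀)⁻¹ - 1‖ ≤ 2 * rhoS ν := fun σ hσ =>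
    scalar_letters (eps_sigma_le ν c z₀ σ hσ) hρ12
  have hGm : Gam0.map (algebraMap ℝ ℂ) = Gm := rfl
  refine ⟨fun i j => ?_, fun σ hσ b j => ?_, fun σ hσ b j => ?_, fun i j => ?_, fun σ _ => (Matrix.isSymm_one).smul _,
    fun σ hσ b b' => ?_, fun σ hσ b b' => ?_, fun σ hσ b b' => ?_⟩
  · simp only [Gσ, Matrix.smul_apply, smul_eq_mul]
    exact ((differentiableOn_const _).add ((differentiableOn_apply (𝕜 := ℂ) z₀ _).const_mul _)).mul_const _
  · -- |G(σ)| = |1 + εσ₀|·½ ≤ (1 + ρ_σ)∕2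
    have hε := eps_sigma_le ν c z₀ σ hσ
    have h1 : ‖1 + ((rhoS ν / Rsig c : ℝ) : ℂ) * σ z₀‖ ≤ 1 + rhoS ν :=
      (norm_add_le _ _).trans (by rw [norm_one]; linarith)
    rw [hw1, mul_one]
    unfold Gσ
    rw [Matrix.smul_apply, norm_smul, (norm_Gm b j).1]
    nlinarith [norm_nonneg (1 + ((rhoS ν / Rsig c : ℝ) : ℂ) * σ z₀)]
  · -- |G(σ) − Γ₀| = |εσ₀|·½ ≤ ρ_σ∕2
    have hε := eps_sigma_le ν c z₀ σ hσ
    rw [hw1, mul_one, hGm]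
    unfold Gσ
    have h : ((1 + ((rhoS ν / Rsig c : ℝ) : ℂ) * σ z₀) • Gm - Gm) b j = (((rhoS ν / Rsig c : ℝ) : ℂ) * σ z₀) * Gm b j := by
      simp only [Matrix.sub_apply, Matrix.smul_apply, smul_eq_mul]; ring
    rw [h, norm_mul, (norm_Gm b j).1]
    nlinarith [norm_nonneg (((rhoS ν / Rsig c : ℝ) : ℂ) * σ z₀)]
  · simp only [Aσ, Matrix.smul_apply, smul_eq_mul]
    exact ((differentiableOn_const _).add ((differentiableOn_apply (𝕜 := ℂ) z₀ _).const_mul _)).mul_const _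
  · obtain ⟨hne, -, hinv, -⟩ := key σ hσ
    obtain rfl : b = b' := Subsingleton.elim _ _
    unfold Aσ
    rw [smul_one_inv hne, hw1, mul_one, Matrix.smul_apply, Matrix.one_apply_eq, smul_eq_mul, mul_one]
    exact hinv
  · obtain ⟨hne, -, -, hinv1⟩ := key σ hσ
    obtain rfl : b = b' := Subsingleton.elim _ _
    unfold Aσ
    rw [smul_one_inv hne, hmap1, hw1, mul_one, Matrix.sub_apply, Matrix.smul_apply, Matrix.one_apply_eq, smul_eq_mul,
      mul_one]
    exact hinv1
  · obtain ⟨-, hsub, -, -⟩ := key σ hσ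
    obtain rfl : b = b' := Subsingleton.elim _ _
    unfold Aσ
    rw [inv_one, hmap1, hw1, mul_one, Matrix.sub_apply, Matrix.smul_apply, Matrix.one_apply_eq, smul_eq_mul, mul_one]
    exact hsub

/-- **σ-DEPENDENCE OF THE MODEL PRECISION**: the admissible configuration `σ ≡ 1` (inside the polydisc, `R_σ > 1`) gives
`A(σ) ≠ A(0)`; so the witnessed kernel is NOT σ-constant. [cite: Balaban1988RG2Cluster, (2.16)–(2.17) p.16] -/
theorem Aσ_ne {ι : Type*} (c : B13.Consts) (z₀ : ι) :
    (∀ j : ι, (fun _ => (1 : ℂ)) j ∈ ball (0 : ℂ) (Rsig c)) ∧ Aσ c ν z₀ (fun _ => (1 : ℂ)) ≠ Aσ c ν z₀ (fun _ => 0) := by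
  have hR : 1 < Rsig c := by unfold Rsig; linarith [Real.exp_pos c.κ₁]
  have hρ := (rhoS_pos_le ν).1
  have hRp := Rsig_pos c
  refine ⟨fun _ => by simpa using hR, fun h => ?_⟩
  have h0 := congrFun (congrFun h 0) 0
  simp only [Aσ, Matrix.smul_apply, Matrix.one_apply_eq, smul_eq_mul, mul_one, mul_zero, add_zero] at h0
  have h1 : ((rhoS ν / Rsig c : ℝ) : ℂ) = 0 := by linear_combination h0
  rw [Complex.ofReal_eq_zero] at h1
  exact (div_pos hρ hRp).ne' h1

end Precision

/-! ## §2. The ν-uniform numerics at `ρ_σ` -/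

section Numbers

variable (ν : ℕ)

/-- The letter transports at the σ-affine model: `ρ_σ < 1`, `(1 + ρ_σ)·(1 + ρ_σ)∕2 ≤ 1`, `(1 − ρ_σ)⁻²·2 ≤ 8`,
`ρ_σ∕2 + ρ_σ·(1 + ρ_σ)∕2 ≤ 2ρ_σ`, `2ρ_σ + ρ_σ(2 + ρ_σ)(1 − ρ_σ)⁻²·2 ≤ 22ρ_σ`, `ρ_σ + ρ_σ(2 + ρ_σ)(ρ_σ + 1) ≤ 4ρ_σ`,
`(1 + ρ_σ)² ≤ 2`. [cite: Balaban1988RG2Cluster, (2.24) p.17] -/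
theorem transportsS_model :
    rhoS ν < 1 ∧ (1 + rhoS ν) * ((1 + rhoS ν) / 2) ≤ 1 ∧ ((1 - rhoS ν) ^ 2)⁻¹ * 2 ≤ 8 ∧
    rhoS ν / 2 + rhoS ν * ((1 + rhoS ν) / 2) ≤ 2 * rhoS ν ∧
    2 * rhoS ν + rhoS ν * (2 + rhoS ν) * ((1 - rhoS ν) ^ 2)⁻¹ * 2 ≤ 22 * rhoS ν ∧
    rhoS ν + rhoS ν * (2 + rhoS ν) * (rhoS ν + 1) ≤ 4 * rhoS ν ∧ (1 + rhoS ν) ^ 2 ≤ 2 := by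
  obtain ⟨h0, h1⟩ := rhoS_pos_le ν
  have hinv : ((1 - rhoS ν) ^ 2)⁻¹ ≤ 4 := by
    calc ((1 - rhoS ν) ^ 2)⁻¹ ≤ ((1 / 4 : ℝ))⁻¹ := inv_anti₀ (by norm_num) (by nlinarith)
      _ = 4 := by norm_num
  have h6 : rhoS ν * (2 + rhoS ν) * (rhoS ν + 1) ≤ rhoS ν * 3 := by
    have h2 : (2 + rhoS ν) * (rhoS ν + 1) ≤ 3 := by nlinarith
    calc rhoS ν * (2 + rhoS ν) * (rhoS ν + 1) = rhoS ν * ((2 + rhoS ν) * (rhoS ν + 1)) := by ring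
      _ ≤ rhoS ν * 3 := mul_le_mul_of_nonneg_left h2 h0.le
  refine ⟨by linarith, by nlinarith, by linarith, by nlinarith, ?_, by linarith, by nlinarith⟩
  have h2 : rhoS ν * (2 + rhoS ν) ≤ rhoS ν * (5 / 2) := mul_le_mul_of_nonneg_left (by linarith) h0.le
  have h3 : rhoS ν * (2 + rhoS ν) * ((1 - rhoS ν) ^ 2)⁻¹ * 2 ≤ rhoS ν * (5 / 2) * 4 * 2 :=
    mul_le_mul_of_nonneg_right (mul_le_mul h2 hinv (by positivity) (by positivity)) (by norm_num)
  linarith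

/-- `4ρ_σ ≤ θ` and `2ρ_σ ≤ θ` (`θ = 1∕(16·9^ν)` of module 52). [cite: Balaban1988RG2Cluster, (2.24) p.17] -/
theorem rhoS_le_thetaW : 4 * rhoS ν ≤ thetaW ν ∧ 2 * rhoS ν ≤ thetaW ν := by
  have hu : (1 : ℝ) ≤ (3 : ℝ) ^ ν := one_le_pow₀ (by norm_num)
  set u := (3 : ℝ) ^ ν with hu_def
  have h4 : (1 : ℝ) ≤ u ^ 2 := one_le_pow₀ hu
  have key : 4 * rhoS ν ≤ thetaW ν := by
    unfold rhoS thetaW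
    rw [← hu_def, mul_one_div, div_le_div_iff₀ (by positivity) (by positivity)]
    nlinarith [h4, sq_nonneg u]
  have := (rhoS_pos_le ν).1
  exact ⟨key, by linarith⟩

/-- The R1-letter condition at the σ-affine model: `3^ν·3^ν·(2ρ_σ·8·1 + ½·22ρ_σ·1 + ½·1·2ρ_σ) ≤ θ` (`56∕1024 ≤ 64∕1024`).
[cite: Balaban1988RG2Cluster, (2.24) p.17] -/
theorem hθR1le_S_model :
    ((1 : ℕ) : ℝ) * (1 + 2 / (3 - 2)) ^ ν * (((1 : ℕ) : ℝ) * (1 + 2 / (2 - 1)) ^ ν)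
      * (2 * rhoS ν * 8 * 1 + 1 / 2 * (22 * rhoS ν) * 1 + 1 / 2 * 1 * (2 * rhoS ν)) ≤ thetaW ν := by
  obtain ⟨h1, h2, -, -, -⟩ := fibreFactors_model ν
  rw [h1, h2]
  have hu : (1 : ℝ) ≤ (3 : ℝ) ^ ν := one_le_pow₀ (by norm_num)
  set u := (3 : ℝ) ^ ν with hu_def
  have hρ : u * u * (2 * rhoS ν * 8 * 1 + 1 / 2 * (22 * rhoS ν) * 1 + 1 / 2 * 1 * (2 * rhoS ν))
      = 56 / 1024 * (1 / u ^ 2) := by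
    unfold rhoS; rw [← hu_def]; field_simp; ring
  have hθ : thetaW ν = 64 / 1024 * (1 / u ^ 2) := by
    unfold thetaW; rw [← hu_def]; field_simp; ring
  rw [hρ, hθ]
  exact mul_le_mul_of_nonneg_right (by norm_num) (by positivity)

end Numbers

/-! ## §3. THE WITNESS with the σ-affine precision -/

section Witness

variable {d L N' : ℕ} [NeZero L] [NeZero N'] {M : ℕ}

open Classical in
/-- **JOINT SATISFIABILITY OF THE (2.26) CAPSTONE's BINDER LIST WITH σ-DEPENDENT KERNELS (A2 ∕ A6 WITNESS):**
`B13Term214WindowDilated.h226_torus_windowDilated_of_primitives` APPLIED, with EVERY binder discharged, at the model of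
`B13Bound226Witness.h226_windowDilated_model` with the kernels replaced by the σ-AFFINE `A(σ) = (1 + (ρ_σ∕R_σ)σ(z₀))·1`,
`G(σ) = (1 + (ρ_σ∕R_σ)σ(z₀))·Γ₀`, `Γ(σ)X = G(σ)·X` on the σ-polydisc `ball 0 R_σ` (`R_σ = e^{κ₁} + 1`; any block `z₀`): letters
`θ_E = ρ_σ`, `θ_C = 2ρ_σ`, `θ_Γ = ρ_σ∕2`, `K_{Cσ} = 2`, `K_G = (1 + ρ_σ)∕2` (`lettersS_model`), primed letters `K_G′ = 1`,
`K_{Cσ}′ = 8`, `θ_Γ′ = 2ρ_σ`, `θ_C′ = 22ρ_σ`, `θ_E′ = 4ρ_σ`, `b`-ball radius `ρ_σ = 1∕(512·81^ν) > 0`, `θ = 1∕(16·9^ν)`; everything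
else (real references, characteristic functions with (2.22), potentials with (2.20), τ-regions, rates, `c_E = 1`, `g = ¼`,
`a = r_P²∕16`, `a₅ = 1 + 4S`) as in module 52, by name.  `Re(b²A(σ)) ≻ 0` is DERIVED by the engine from the E-letter at
`θ_E = ρ_σ ≠ 0`.  The kernels are NOT σ-constant (`Aσ_ne`), so the honesty theorem `B13SigmaFreeKernels.term214_sigmaFree` does
not apply to the witnessed term.  HONEST: still a consistency certificate (value not computed; one bond); nothing of Bałaban's
asserted.
[cite: Balaban1988RG2Cluster, (2.14)–(2.15) p.15, (2.16)–(2.22) p.16, (2.23)–(2.26) p.17] -/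
theorem h226_windowDilated_sigma_model {ν : ℕ} (Nf : Fin ν → ℕ) [∀ i, NeZero (Nf i)] (c : B13.Consts) (hκ₁ : 1 ≤ c.κ₁)
    (hα₆ : c.α₆ ≠ 0) (hτ : ∀ x : ℝ, 0 ≤ x → 0 < invTau c x ∧ invTau c x ≤ 1 / 2)
    (Z : TDom d N') (t : Finset (TDom d (L * N')) × Finset (TBond d M (L * N'))) (rP : ℝ) (z₀ : TPt d N') :
    ∀ b ∈ ball (1 : ℂ) (rhoS ν),
      ‖term214 (Real.exp c.κ₁ - 1) (Z.1 \ tclosure L N' (Z0 M t)).toList t.1.toList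
          (core214 (fun σ => b ^ 2 • Aσ c ν z₀ σ) (fun σ X => b • Γσ c ν z₀ σ X)
            (F214 t.2.card (chiS (rP ^ 2 * t.2.card + 1)) (chiL (rP ^ 2 * t.2.card)) t.1
              (fun Y B => b ^ 2 * Wq (etaW c t) Y B + Oc 1 Y B))) 0 0‖ ≤
        weight L M c Z (1 / 16 * rP ^ 2) t * Real.exp ((1 + 4 * SR c t) * ((Z.1).card : ℝ)) := by
  obtain ⟨hpos, hhalf, hr, hUtau, hsubτ⟩ := regions_model c hκ₁ hτ (d := d) (L := L) (N' := N')
  have hS := SR_nonneg c t hτ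
  obtain ⟨hη, hrate⟩ := etaW_pos_and_rate c t hτ
  obtain ⟨⟨hρ1, hKG', hKCs', hθΓ', hθC', hθE', hsq2⟩, ⟨hθEle, hθΓle⟩, ⟨-, hsmallKθ⟩, h2θ⟩ :=
    And.intro (transportsS_model ν) (And.intro (rhoS_le_thetaW ν) (And.intro (hsmallKθ_model ν) (two_theta_F_le ν)))
  obtain ⟨-, hΓ₀, -, hC216, hCE, -, -, -⟩ := letters_model Nf (ι := TPt d N')
  obtain ⟨hGhol, hG, hdΓ, hAhol, hAs, hCs, hdC, hdE⟩ := lettersS_model ν Nf c z₀ (ι := TPt d N')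
  have hρ0 := (rhoS_pos_le ν).1
  have hZ1 : (1 : ℝ) ≤ ((Z.1).card : ℝ) := by exact_mod_cast Finset.card_pos.mpr Z.2.1
  have hvol := vol_model ν (by positivity : (0 : ℝ) ≤ 4 * SR c t) hZ1
  have hUexp : closedBall (0 : ℂ) (Real.exp c.κ₁) ⊆ ball (0 : ℂ) (Rsig c) :=
    closedBall_subset_ball (by unfold Rsig; linarith)
  intro b hb
  exact h226_torus_windowDilated_of_primitives c hκ₁ hα₆ Z t hpos hhalf (Uσ := ball (0 : ℂ) (Rsig c))
    (Uτ := fun Y => ball (0 : ℂ) (Rτ c Y)) isOpen_ball (fun _ => isOpen_ball) hUexp hUtau hr le_rfl hsubτ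
    _ ⟨Finset.nodup_toList _, Finset.toList_toFinset _⟩ _ ⟨Finset.nodup_toList _, Finset.toList_toFinset _⟩
    (Aσ c ν z₀) (Γσ c ν z₀) (chiS (rP ^ 2 * t.2.card + 1)) (chiL (rP ^ 2 * t.2.card))
    (chiS_nonneg _) (chiL_nonneg _) t.1 (Wq (etaW c t)) (Oc 1) Matrix.PosDef.one Gam0
    hAhol (measurable_chiS _) (measurable_chiL _) (fun Y => measurable_Wq _ Y)
    (fun Y => measurable_Oc _ Y) hAs (Gσ c ν z₀) hGhol
    (fun _ _ _ => rfl) (γ₂ := 1 / 16) (rP := rP) (a₂₀ := 2 * (etaW c t * SR c t)) (w := 1 * SR c t) (fun B => B ⬝ᵥ B)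
    (fun B => h222_model _ (by norm_num) rP t.2.card B) (by norm_num) (fun _ => le_rfl) (by positivity)
    (fun τ hτ' B => h220_model t.1 hη.le zero_le_one τ (fun Y _ => (mem_ball_zero_iff.mp (hτ' Y)).le) B)
    (fun _ => x0 Nf) (fun _ => x0 Nf) (m := 1) (fib_model_Λ Nf) (fib_model_N Nf)
    (kap := 3) (kap' := 2) (kap'' := 1) (θ := thetaW ν) (θE := rhoS ν) (θΓ := rhoS ν / 2) (θC := 2 * rhoS ν)
    (KG := (1 + rhoS ν) / 2) (KΓ := 1 / 2) (KCs := 2) (K₀ := 1) (KE := 1) (by norm_num) (by norm_num) (by norm_num) hρ0.le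
    (by positivity) (by positivity) (by positivity) (by norm_num) (by norm_num) zero_le_one zero_le_one
    hG hΓ₀ hCs hC216 hCE hdΓ hdC hdE
    (ρb := rhoS ν) (KG' := 1) (KCs' := 8) (θΓ' := 2 * rhoS ν) (θC' := 22 * rhoS ν) (θE' := 4 * rhoS ν) (a' := 1 / 16)
    (w' := 4 * SR c t) hρ1 hKG' hKCs' hθΓ' hθC' hθE'
    (by nlinarith [hrate, hsq2, hη.le, hS]) (by nlinarith [hsq2, hS]) hθEle hθΓle (hθR1le_S_model ν) hsmallKθ
    (cE := 1) (g := 1 / 4) zero_le_one (eigenvalues_one_le Matrix.PosDef.one) (by nlinarith [h2θ]) (by norm_num) Gam0_form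
    (by nlinarith [h2θ]) (a := 1 / 16 * rP ^ 2) (a₅ := 1 + 4 * SR c t) le_rfl hvol b hb

/-- THE `b`-BALL OF THE σ-AFFINE MODEL IS NOT EMPTY: `b = 1` lies in it. [cite: Balaban1988RG2Cluster, (2.24) p.17] -/
theorem one_mem_ball_rhoS (ν : ℕ) : (1 : ℂ) ∈ ball (1 : ℂ) (rhoS ν) := mem_ball_self (rhoS_pos_le ν).1

end Witness

end Literature.MathematicalPhysics.QuantumFieldTheory.Balaban1983to89.B13Bound226WitnessSigma

end
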